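import Mathlib.Analysis.Calculus.ParametricIntegral
import Mathlib.Analysis.Calculus.BumpFunction.InnerProduct
import Mathlib.Analysis.Calculus.FDeriv.Symmetric
import Literature.Geometry.Lorentzian.LandauLifshitzPseudotensor
import Literature.Geometry.Lorentzian.ADMFrameIndependence
import Literature.MeasureTheory.Hausdorff.SphereMeasure
import HarnessLib

/-!
# The Landau–Lifshitz flux laws on coordinate spheres

Landau–Lifshitz, *The Classical Theory of Fields*, §96: the total four-momentum (96.11) and angular
four-momentum (96.13) of field plus matter are conserved because the energy–momentum complex
`(−g)(T^{ik} + t^{ik}) = ∂_l h^{ikl}` (96.5) is the divergence of a superpotential antisymmetric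
in its last two indices, and both charges are surface integrals ((96.16), (96.17)). This file
PROVES the corresponding **balance laws on a fixed coordinate sphere** `S = {x⁰ = t, |y − ξ| = R}`
for the quasi-local charges of `LandauLifshitzPseudotensor.lean`, for every field of components
`g` that is `C^∞` and nondegenerate (and, for `M`, symmetric) on an open set containing the
sphere — no field equations and NO INTERIOR are needed (black holes may sit inside the sphere):

* `hasDerivAt_quasiLocalMomentum` —
  `d/dt P^μ(t; ξ, R) = −∮_S Σ_k emComplex^{μk} n_k dσ` (LL (96.10) with (96.16));
  `hasDerivAt_quasiLocalMomentum_of_ricciFlat` — where `Ric(g) = 0` the complex is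
  `(−g) t^{μk}_LL`, so `d/dt P^μ = −momentumFlux` (LL (96.11)–(96.12); the shape of clause (iv) of
  the route item `LLBalanceLaw` of `EIHFluxBalance`);
* `hasDerivAt_angularMomentumChargeAbout` (and `…_of_metricDet_neg`) —
  `d/dt M_a^{μν}(t; ξ, R) = −angularMomentumFluxAbout = −∮_S Σ_k [(x−a)^μ τ^{νk} − (x−a)^ν τ^{μk}] n_k dσ`
  for every FIXED reference event `a` (LL (96.10) with (96.13), (96.17)).

Both are instances of one mechanism, `hasDerivAt_sphereCharge_of_antisymm`: for functions
`Φ^{λα}` antisymmetric in `(λ, α)` and `C²` near the slice, with divergence `J^λ = Σ_α ∂_α Φ^{λα}`,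
the sphere charge `Q(s) = ∮ Σ_k Φ^{0k}(s, y) n_k dσ` has `dQ/dt = −∮ Σ_k J^k n_k dσ`, because
`∂_0 Φ^{0k} = −J^k + Σ_b ∂_b Φ^{kb}` and the last term is a spatial curl, whose flux through a closed
sphere vanishes. For `P^μ`, `Φ^{λα} = h^{μλα}` (antisymmetric by (96.4), `J = emComplex` by
definition). For `M_a^{μν}`, `Φ^{λα} = Ψ_a^{μν|λα} = (x−a)^μ h^{νλα} − (x−a)^ν h^{μλα} + λ^{μλαν}`
(`amSuperpotential`), and `Σ_α ∂_α Ψ_a^{μν|λα} = amComplex^{μνλ}` (`sum_partialDeriv_amSuperpotential`)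
is LL's integration by parts behind (96.17): the lever arms produce `h^{νλμ} − h^{μλν}`, which
cancels against `Σ_α ∂_α λ^{μλαν} = h^{λμν}` (`sum_partialDeriv_lambdaLL`) by the cyclic identity
`h^{ilk} + h^{kil} + h^{lki} = 0` (`hField_cyclic`, from `superpotential_cyclic`) and (96.4).

## The analytic steps (all proved here)

* `exists_shell_cutoff` — a smooth cut-off equal to `1` near a round sphere, supported in a shell
  inside a given open set (two Mathlib bump functions);
* `setIntegral_sphere_curl_eq_zero`, `setIntegral_sphere_curl_eq_zero'` — **curl fields have no
  flux through coordinate spheres**: `∮ Σ_a (Σ_b ∂_b W^{ab}) n_a dμHE[2] = 0` for `W` antisymmetric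
  and `C²` near the sphere (cut off, then `ADMFrameIndependence.sphereIntegral_admVec_eq_zero_of_antisymm`
  — Gauss–Green on shells — and `SphereMeasure.setIntegral_sphere_euclideanHausdorff`; any centre by
  translation invariance of `μHE[2]`);
* slice calculus `s ↦ (s, y)`, `y ↦ (t, y)` (`hasDerivAt_slice_time`, `hasFDerivAt_slice`,
  `fderiv_comp_slice`, `hasDerivAt_comp_slice_time`, `continuous_slice_uncurry`);
* `hasDerivAt_setIntegral_sphere` — differentiation of `∮ F(s, y) dμHE[2](y)` under the integral
  sign (tube lemma + dominated differentiation; the sphere has finite `μHE[2]`-measure);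
* smoothness on `U` of `g_{μν}`, `det`, `adj`, `g^{μν}`, `H`, `λ`, `h`, `emComplex`, `Ψ_a`
  (`…_contDiffOn`; Leibniz formula and Cramer's rule, as in the route helper
  `Theorems/EIHFluxBalanceLLBalanceLawIdentities.lean`, which Literature cannot import).

## References

* L. D. Landau, E. M. Lifshitz, *The Classical Theory of Fields*, 4th English ed., Pergamon 1975,
  §96, (96.4)–(96.5), (96.10)–(96.13), (96.16)–(96.17) (key `LandauLifshitz1975`).
* C. W. Misner, K. S. Thorne, J. A. Wheeler, *Gravitation*, 1973, §20.2, (20.6)–(20.9)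
  (key `MisnerThorneWheeler1973`).
* R. Bartnik, *The mass of an asymptotically flat manifold*, CPAM 39 (1986), (4.9) (the curl
  cancellation on round spheres, key `Bartnik1986`).
-/

noncomputable section

-- instance search on the nested operator spaces `E3 →L[ℝ] E3 →L[ℝ] ℝ` is deep (as in
-- `ADMFrameIndependence.lean`)
set_option maxSynthPendingDepth 3

open TopologicalSpace Filter Set Function
open _root_.MeasureTheory _root_.MeasureTheory.Measure
open scoped Topology ContDiff Matrix RealInnerProductSpace

namespace Literature.Geometry.Lorentzian

namespace LandauLifshitz


/-! ### A smooth cut-off equal to `1` near a round sphere and supported in a shell -/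

/-- **Shell cut-off.** For an open set `V ⊆ E3` containing the round sphere `{‖y‖ = r}`, `r > 0`,
there are a smooth (`C^n` for every `n : ℕ∞`) function `χ` and `δ > 0` with `χ = 1` on the open
shell `{r − δ < ‖y‖ < r + δ}`, `χ = 0` on the closed ball `{‖y‖ ≤ r − 2δ}` (and `r − 2δ > 0`), and
`tsupport χ ⊆ V`
(difference of two Mathlib bump functions centred at the origin). [folklore] -/
theorem exists_shell_cutoff {V : Set E3} (hV : IsOpen V) {r : ℝ} (hr : 0 < r)
    (hS : Metric.sphere (0 : E3) r ⊆ V) :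
    ∃ (χ : E3 → ℝ) (δ : ℝ), (∀ n : ℕ∞, ContDiff ℝ n χ) ∧ 0 < δ ∧ 2 * δ < r ∧
      (∀ y : E3, r - δ < ‖y‖ → ‖y‖ < r + δ → χ y = 1) ∧
      (∀ y : E3, ‖y‖ ≤ r - 2 * δ → χ y = 0) ∧ tsupport χ ⊆ V := by
  obtain ⟨δ₀, hδ₀, hδ₀V⟩ := (isCompact_sphere (0 : E3) r).exists_cthickening_subset_open hV hS
  set δ : ℝ := min δ₀ r / 4 with hδ
  have hδpos : 0 < δ := by
    have : 0 < min δ₀ r := lt_min hδ₀ hr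
    positivity
  have hδδ₀ : 4 * δ ≤ δ₀ := by
    have : min δ₀ r ≤ δ₀ := min_le_left _ _
    linarith
  have hδr : 4 * δ ≤ r := by
    have : min δ₀ r ≤ r := min_le_right _ _
    linarith
  -- the two bumps
  let fo : ContDiffBump (0 : E3) := ⟨r + δ, r + 2 * δ, by linarith, by linarith⟩
  let fi : ContDiffBump (0 : E3) := ⟨r - 2 * δ, r - δ, by linarith, by linarith⟩
  refine ⟨fun y ↦ fo y - fi y, δ, fun n ↦ fo.contDiff.sub fi.contDiff, hδpos, by linarith,
    ?_, ?_, ?_⟩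
  · intro y h1 h2
    have ho : fo y = 1 := fo.one_of_mem_closedBall (by
      rw [Metric.mem_closedBall, dist_zero_right]; exact h2.le)
    have hi : fi y = 0 := fi.zero_of_le_dist (by
      rw [dist_zero_right]; exact h1.le)
    simp only [ho, hi, sub_zero]
  · intro y hy
    have ho : fo y = 1 := fo.one_of_mem_closedBall (by
      rw [Metric.mem_closedBall, dist_zero_right]; linarith)
    have hi : fi y = 1 := fi.one_of_mem_closedBall (by
      rw [Metric.mem_closedBall, dist_zero_right]; exact hy)
    simp only [ho, hi, sub_self]
  · -- the support lies in the closed shell `{r − 2δ ≤ ‖y‖ ≤ r + 2δ} ⊆ cthickening δ₀ (sphere)`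
    have hsupp : Function.support (fun y ↦ fo y - fi y) ⊆
        {y : E3 | r - 2 * δ ≤ ‖y‖ ∧ ‖y‖ ≤ r + 2 * δ} := by
      intro y hy
      rw [Function.mem_support] at hy
      by_contra hc
      simp only [Set.mem_setOf_eq, not_and_or, not_le] at hc
      rcases hc with hlt | hgt
      · have ho : fo y = 1 := fo.one_of_mem_closedBall (by
          rw [Metric.mem_closedBall, dist_zero_right]; linarith)
        have hi : fi y = 1 := fi.one_of_mem_closedBall (by
          rw [Metric.mem_closedBall, dist_zero_right]; exact hlt.le)
        exact hy (by simp only [ho, hi, sub_self])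
      · have ho : fo y = 0 := fo.zero_of_le_dist (by
          rw [dist_zero_right]; exact hgt.le)
        have hi : fi y = 0 := fi.zero_of_le_dist (by
          rw [dist_zero_right]; linarith)
        exact hy (by simp only [ho, hi, sub_self])
    have hclosed : IsClosed {y : E3 | r - 2 * δ ≤ ‖y‖ ∧ ‖y‖ ≤ r + 2 * δ} :=
      (isClosed_le continuous_const continuous_norm).inter
        (isClosed_le continuous_norm continuous_const)
    refine (closure_minimal hsupp hclosed).trans (Set.Subset.trans ?_ hδ₀V)
    rintro y ⟨h1, h2⟩
    have hy0 : 0 < ‖y‖ := by linarith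
    have hyne : y ≠ 0 := norm_pos_iff.1 hy0
    refine Metric.mem_cthickening_of_dist_le y ((r / ‖y‖) • y) δ₀ _ ?_ ?_
    · rw [mem_sphere_zero_iff_norm, norm_smul, Real.norm_eq_abs, abs_of_pos (by positivity),
        div_mul_cancel₀ _ hy0.ne']
    · have hdist : dist y ((r / ‖y‖) • y) = |‖y‖ - r| := by
        rw [dist_eq_norm, show y - (r / ‖y‖) • y = (1 - r / ‖y‖) • y by rw [sub_smul, one_smul],
          norm_smul, Real.norm_eq_abs, show (1 - r / ‖y‖) = (‖y‖ - r) / ‖y‖ by field_simp,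
          abs_div, abs_of_pos hy0, div_mul_cancel₀ _ hy0.ne']
      rw [hdist]
      have : |‖y‖ - r| ≤ 2 * δ := abs_le.2 ⟨by linarith, by linarith⟩
      linarith

/-! ### Curl fields have no flux through coordinate spheres -/

/-- **Curl fields have no flux through round spheres about the origin (local form).** If the
`W^{ab}` are antisymmetric and `C²` on an open set containing the sphere `{‖y‖ = r}`, `r > 0`, then
`∮_{‖y‖=r} Σ_a (Σ_b ∂_b W^{ab}) y_a / r dμHE[2] = 0`. Proof: cut `W` off to a `C²` antisymmetric
family on all of `E3` vanishing near the origin and unchanged near the sphere, and apply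
`sphereIntegral_admVec_eq_zero_of_antisymm` (Gauss–Green on shells, Bartnik's "curious
cancellation") together with the identification of `μHE[2]` on round spheres with the polar
surface measure (`setIntegral_sphere_euclideanHausdorff`). [folklore] -/
theorem setIntegral_sphere_curl_eq_zero {V : Set E3} (hV : IsOpen V) {r : ℝ} (hr : 0 < r)
    (hS : Metric.sphere (0 : E3) r ⊆ V) {W : E3 → Fin 3 → Fin 3 → ℝ}
    (hanti : ∀ y a b, W y a b = -W y b a) (hW : ∀ a b, ContDiffOn ℝ 2 (fun y ↦ W y a b) V) :
    ∫ y in Metric.sphere (0 : E3) r, ∑ a : Fin 3,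
      (∑ b : Fin 3, fderiv ℝ (fun z ↦ W z a b) y (EuclideanSpace.single b 1)) * y a / r
        ∂(μHE[2] : Measure E3) = 0 := by
  classical
  obtain ⟨χ, δ, hχ, hδ, hδr, hone, hzero, hsupp⟩ := exists_shell_cutoff hV hr hS
  -- the cut-off family
  set Wc : E3 → Fin 3 → Fin 3 → ℝ := fun y a b ↦ χ y * W y a b with hWc
  have hWc_anti : ∀ y a b, Wc y a b = -Wc y b a := fun y a b ↦ by
    simp only [hWc, hanti y a b, mul_neg]
  have hWc_smooth : ∀ a b, ContDiff ℝ 2 fun y ↦ Wc y a b := by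
    intro a b
    refine contDiff_iff_contDiffAt.2 fun y ↦ ?_
    by_cases hy : y ∈ V
    · exact (hχ 2).contDiffAt.mul ((hW a b).contDiffAt (hV.mem_nhds hy))
    · have hy' : y ∉ tsupport χ := fun h ↦ hy (hsupp h)
      rw [notMem_tsupport_iff_eventuallyEq] at hy'
      have hev : (fun y ↦ Wc y a b) =ᶠ[𝓝 y] fun _ ↦ 0 := by
        filter_upwards [hy'] with z hz
        simp only [hWc, hz, Pi.zero_apply, zero_mul]
      exact (contDiffAt_const (c := (0 : ℝ))).congr_of_eventuallyEq hev
  have hWc_zero : ∀ y : E3, ‖y‖ ≤ r - 2 * δ → ∀ a b, Wc y a b = 0 := fun y hy a b ↦ by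
    simp only [hWc, hzero y hy, zero_mul]
  -- near the sphere the cut-off family agrees with `W`
  have hWc_eq : ∀ y ∈ Metric.sphere (0 : E3) r, ∀ a b,
      fderiv ℝ (fun z ↦ Wc z a b) y = fderiv ℝ (fun z ↦ W z a b) y := by
    intro y hy a b
    refine Filter.EventuallyEq.fderiv_eq ?_
    have hyr : ‖y‖ = r := mem_sphere_zero_iff_norm.1 hy
    have hmem : {z : E3 | r - δ < ‖z‖ ∧ ‖z‖ < r + δ} ∈ 𝓝 y :=
      ((isOpen_lt continuous_const continuous_norm).inter
        (isOpen_lt continuous_norm continuous_const)).mem_nhds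
          ⟨show r - δ < ‖y‖ by rw [hyr]; linarith, show ‖y‖ < r + δ by rw [hyr]; linarith⟩
    filter_upwards [hmem] with z hz
    simp only [hWc, hone z hz.1 hz.2, one_mul]
  -- the bilinear-form field `β(y)(v, w) = Σ_{ab} Wc^{ab}(y) v_a w_b` and its ADM (curl) vector
  set b3 := EuclideanSpace.basisFun (Fin 3) ℝ with hb3
  set β : E3 → E3 →L[ℝ] E3 →L[ℝ] ℝ := fun y ↦ ∑ a : Fin 3, ∑ b : Fin 3, Wc y a b •
    (EuclideanSpace.proj a : E3 →L[ℝ] ℝ).smulRight (EuclideanSpace.proj b : E3 →L[ℝ] ℝ) with hβdef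
  have hβapply : ∀ y v w : E3, β y v w = ∑ a : Fin 3, ∑ b : Fin 3, Wc y a b * (v a * w b) := by
    intro y v w
    simp only [hβdef, _root_.sum_apply, _root_.smul_apply, ContinuousLinearMap.smulRight_apply,
      smul_eq_mul, PiLp.proj_apply]
  have hβsingle : ∀ (y : E3) (i j : Fin 3),
      β y (EuclideanSpace.single i 1) (EuclideanSpace.single j 1) = Wc y i j := by
    intro y i j
    rw [hβapply]
    simp only [PiLp.single_apply, mul_ite, mul_one, mul_zero]
    simp [Finset.sum_ite_eq']
  set c : E3 → E3 := fun y ↦ ∑ i, (∑ j, (fderiv ℝ (fun z ↦ β z (b3 i) (b3 j)) y (b3 j) -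
    fderiv ℝ (fun z ↦ β z (b3 j) (b3 j)) y (b3 i))) • b3 i with hcdef
  have hβ2 : ContDiff ℝ 2 β := by
    simp only [hβdef]
    exact ContDiff.sum fun a _ ↦ ContDiff.sum fun b _ ↦ (hWc_smooth a b).smul contDiff_const
  have hβanti : ∀ y v w, β y v w = -β y w v := by
    intro y v w
    rw [hβapply, hβapply, Finset.sum_comm, ← Finset.sum_neg_distrib]
    refine Finset.sum_congr rfl fun b _ ↦ ?_
    rw [← Finset.sum_neg_distrib]
    refine Finset.sum_congr rfl fun a _ ↦ ?_
    rw [hWc_anti y a b]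
    ring
  have hR₀ : 0 < r - 2 * δ := by linarith
  have hβzero : ∀ y : E3, ‖y‖ ≤ r - 2 * δ → β y = 0 := by
    intro y hy
    ext v w
    rw [hβapply]
    simp [hWc_zero y hy]
  have hflux := sphereIntegral_admVec_eq_zero_of_antisymm (volume : Measure E3) b3
    (fun y ↦ rfl) hβ2 hβanti hR₀ hβzero hr (c := c)
  -- convert the polar sphere integral into the Hausdorff surface integral
  have hd : Module.finrank ℝ E3 = 2 + 1 := by simp
  have hHE := Literature.MeasureTheory.Hausdorff.setIntegral_sphere_euclideanHausdorff (E := E3)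
    hd hr (fun x ↦ ⟪‖x‖⁻¹ • x, c x⟫)
  rw [hflux, smul_zero] at hHE
  rw [← hHE]
  refine setIntegral_congr_fun Metric.isClosed_sphere.measurableSet fun x hx ↦ ?_
  have hxr : ‖x‖ = r := mem_sphere_zero_iff_norm.1 hx
  -- components of `β` in the standard basis
  have hβij : ∀ i j, (fun z ↦ β z (b3 i) (b3 j)) = fun z ↦ Wc z i j := by
    intro i j
    funext z
    simp only [hb3, EuclideanSpace.basisFun_apply, hβsingle]
  have hdiag : ∀ j v, fderiv ℝ (fun z ↦ W z j j) x v = 0 := by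
    intro j v
    have h0 : (fun z ↦ W z j j) = fun _ ↦ (0 : ℝ) := by
      funext z
      have := hanti z j j
      linarith
    rw [h0]
    simp
  simp only [hcdef, inner_sum, inner_smul_right, hβij, hWc_eq x hx, hdiag, sub_zero]
  refine Finset.sum_congr rfl fun i _ ↦ ?_
  rw [hb3, EuclideanSpace.basisFun_apply, EuclideanSpace.inner_single_right]
  simp only [one_mul, PiLp.smul_apply, smul_eq_mul, hxr, conj_trivial]
  simp only [EuclideanSpace.basisFun_apply]
  ring

/-- **Curl fields have no flux through coordinate spheres (any centre).** Translation of
`setIntegral_sphere_curl_eq_zero` by the isometry `y ↦ y + ξ` (which preserves `μHE[2]`): if the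
`W^{ab}` are antisymmetric and `C²` on an open set containing `{|y − ξ| = r}`, `r > 0`, then
`∮_{|y−ξ|=r} Σ_a (Σ_b ∂_b W^{ab})(y) (y − ξ)_a / r dμHE[2] = 0`. [folklore] -/
theorem setIntegral_sphere_curl_eq_zero' {V : Set E3} (hV : IsOpen V) {ξ : E3} {r : ℝ} (hr : 0 < r)
    (hS : Metric.sphere ξ r ⊆ V) {W : E3 → Fin 3 → Fin 3 → ℝ}
    (hanti : ∀ y a b, W y a b = -W y b a) (hW : ∀ a b, ContDiffOn ℝ 2 (fun y ↦ W y a b) V) :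
    ∫ y in Metric.sphere ξ r, ∑ a : Fin 3,
      (∑ b : Fin 3, fderiv ℝ (fun z ↦ W z a b) y (EuclideanSpace.single b 1)) * (y - ξ) a / r
        ∂(μHE[2] : Measure E3) = 0 := by
  -- translate to the origin
  set W₀ : E3 → Fin 3 → Fin 3 → ℝ := fun z a b ↦ W (z + ξ) a b with hW₀
  have hV₀ : IsOpen ((fun z : E3 ↦ z + ξ) ⁻¹' V) := hV.preimage (continuous_id.add continuous_const)
  have hS₀ : Metric.sphere (0 : E3) r ⊆ (fun z : E3 ↦ z + ξ) ⁻¹' V := by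
    intro z hz
    refine hS ?_
    rw [Metric.mem_sphere, dist_eq_norm, add_sub_cancel_right, ← dist_zero_right]
    exact hz
  have hW₀anti : ∀ y a b, W₀ y a b = -W₀ y b a := fun y a b ↦ hanti _ a b
  have hW₀smooth : ∀ a b, ContDiffOn ℝ 2 (fun y ↦ W₀ y a b) ((fun z : E3 ↦ z + ξ) ⁻¹' V) :=
    fun a b ↦ (hW a b).comp (contDiff_id.add contDiff_const).contDiffOn (fun z hz ↦ hz)
  have h0 := setIntegral_sphere_curl_eq_zero hV₀ hr hS₀ hW₀anti hW₀smooth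
  -- the translation preserves the surface measure and maps the sphere to the sphere
  set e : E3 ≃ᵢ E3 := IsometryEquiv.vaddConst ξ with he
  have hmp : MeasurePreserving e (μHE[2] : Measure E3) (μHE[2] : Measure E3) :=
    e.measurePreserving_euclideanHausdorffMeasure 2
  have hme : MeasurableEmbedding e := e.toHomeomorph.measurableEmbedding
  have hpre : e ⁻¹' Metric.sphere ξ r = Metric.sphere (0 : E3) r := by
    rw [IsometryEquiv.preimage_sphere, he, IsometryEquiv.vaddConst_symm_apply, vsub_self]
  have key := hmp.setIntegral_preimage_emb hme (fun y ↦ ∑ a : Fin 3,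
    (∑ b : Fin 3, fderiv ℝ (fun z ↦ W z a b) y (EuclideanSpace.single b 1)) * (y - ξ) a / r)
    (Metric.sphere ξ r)
  rw [hpre] at key
  rw [← key, ← h0]
  refine setIntegral_congr_fun Metric.isClosed_sphere.measurableSet fun z _ ↦ ?_
  have hderiv : ∀ a b, fderiv ℝ (fun y ↦ W₀ y a b) z = fderiv ℝ (fun y ↦ W y a b) (z + ξ) :=
    fun a b ↦ by
      simp only [hW₀]
      exact fderiv_comp_add_right (f := fun y ↦ W y a b) ξ
  simp only [he, IsometryEquiv.vaddConst_apply, vadd_eq_add, add_sub_cancel_right, hderiv]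

/-! ### Calculus along the slices `s ↦ (s, y)` and `y ↦ (t, y)` -/

/-- The slice embedding `v ↦ (0, v)` of `E3` in `E4` is linear. [folklore] -/
theorem isLinearMap_slice : IsLinearMap ℝ (E4.ofTimeSpace 0) := by
  refine ⟨fun y y' ↦ ?_, fun c y ↦ ?_⟩
  · ext i; refine Fin.cases ?_ (fun j ↦ ?_) i <;> simp
  · ext i; refine Fin.cases ?_ (fun j ↦ ?_) i <;> simp

/-- `(t, y) = (t, 0) + (0, y)`. [folklore] -/
theorem ofTimeSpace_eq_add_slice (t : ℝ) (y : E3) :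
    E4.ofTimeSpace t y = E4.ofTimeSpace t 0 + E4.ofTimeSpace 0 y := by
  ext i
  refine Fin.cases ?_ (fun j ↦ ?_) i <;> simp

/-- `(s, y) = (0, y) + s ∂₀`. [folklore] -/
theorem ofTimeSpace_eq_add_smul (s : ℝ) (y : E3) :
    E4.ofTimeSpace s y = E4.ofTimeSpace 0 y + s • E4.basisVector 0 := by
  ext i
  refine Fin.cases ?_ (fun j ↦ ?_) i
  · simp
  · simp [Fin.succ_ne_zero]

/-- `(0, e_b) = ∂_{b+1}`: the slice embedding sends spatial coordinate vectors to coordinate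
vectors. [folklore] -/
theorem ofTimeSpace_zero_single (b : Fin 3) :
    E4.ofTimeSpace 0 (EuclideanSpace.single b 1) = E4.basisVector b.succ := by
  ext i
  refine Fin.cases ?_ (fun j ↦ ?_) i
  · simp [Fin.succ_ne_zero]
  · simp [PiLp.single_apply, Fin.succ_inj]

/-- The slice map `y ↦ (t, y)` is affine, with differential the (automatically continuous) linear
map `v ↦ (0, v)`. [folklore] -/
theorem hasFDerivAt_slice (t : ℝ) (y : E3) :
    HasFDerivAt (E4.ofTimeSpace t)
      (LinearMap.toContinuousLinearMap (IsLinearMap.mk' _ isLinearMap_slice)) y := by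
  set L := LinearMap.toContinuousLinearMap (IsLinearMap.mk' _ isLinearMap_slice) with hL
  have hLapply : ∀ v, L v = E4.ofTimeSpace 0 v := fun v ↦ rfl
  have h : E4.ofTimeSpace t = fun z ↦ E4.ofTimeSpace t 0 + L z := by
    funext z
    rw [hLapply, ← ofTimeSpace_eq_add_slice]
  rw [h]
  exact L.hasFDerivAt.const_add _

/-- The slice maps are smooth (affine). [folklore] -/
theorem contDiff_slice (t : ℝ) {n : WithTop ℕ∞} : ContDiff ℝ n (E4.ofTimeSpace t) := by
  set L := LinearMap.toContinuousLinearMap (IsLinearMap.mk' _ isLinearMap_slice) with hL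
  have hLapply : ∀ v, L v = E4.ofTimeSpace 0 v := fun v ↦ rfl
  have h : E4.ofTimeSpace t = fun z ↦ E4.ofTimeSpace t 0 + L z := by
    funext z
    rw [hLapply, ← ofTimeSpace_eq_add_slice]
  rw [h]
  exact contDiff_const.add L.contDiff

/-- `s ↦ (s, y)` has derivative `∂₀`. [folklore] -/
theorem hasDerivAt_slice_time (y : E3) (s : ℝ) :
    HasDerivAt (fun s : ℝ ↦ E4.ofTimeSpace s y) (E4.basisVector 0) s := by
  have h : (fun s : ℝ ↦ E4.ofTimeSpace s y) = fun s ↦ E4.ofTimeSpace 0 y + s • E4.basisVector 0 :=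
    funext fun s ↦ ofTimeSpace_eq_add_smul s y
  rw [h]
  simpa using ((hasDerivAt_id s).smul_const (E4.basisVector 0)).const_add (E4.ofTimeSpace 0 y)

/-- `(s, y) ↦ (s, y) ∈ E4` is continuous jointly. [folklore] -/
theorem continuous_slice_uncurry : Continuous fun p : ℝ × E3 ↦ E4.ofTimeSpace p.1 p.2 := by
  have h : (fun p : ℝ × E3 ↦ E4.ofTimeSpace p.1 p.2) =
      fun p ↦ E4.ofTimeSpace 0 p.2 + p.1 • E4.basisVector 0 := by
    funext p
    rw [ofTimeSpace_eq_add_smul]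
  rw [h]
  exact ((E4.continuous_ofTimeSpace 0).comp continuous_snd).add
    (continuous_fst.smul continuous_const)

/-- **Chain rule through the slice**: the spatial coordinate derivative of `y ↦ f (t, y)` is the
coordinate partial derivative `∂_{b+1} f` at `(t, y)`. [folklore] -/
theorem fderiv_comp_slice {f : E4 → ℝ} {t : ℝ} {y : E3}
    (hf : DifferentiableAt ℝ f (E4.ofTimeSpace t y)) (b : Fin 3) :
    fderiv ℝ (fun z ↦ f (E4.ofTimeSpace t z)) y (EuclideanSpace.single b 1) =
      partialDeriv b.succ f (E4.ofTimeSpace t y) := by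
  have h := hf.hasFDerivAt.comp y (hasFDerivAt_slice t y)
  rw [show (fun z ↦ f (E4.ofTimeSpace t z)) = f ∘ E4.ofTimeSpace t from rfl, h.fderiv,
    ContinuousLinearMap.comp_apply, partialDeriv, LinearMap.coe_toContinuousLinearMap',
    IsLinearMap.mk'_apply, ofTimeSpace_zero_single]

/-- **Chain rule in time**: `s ↦ f (s, y)` has derivative `∂₀ f (s, y)`. [folklore] -/
theorem hasDerivAt_comp_slice_time {f : E4 → ℝ} {s : ℝ} {y : E3}
    (hf : DifferentiableAt ℝ f (E4.ofTimeSpace s y)) :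
    HasDerivAt (fun s : ℝ ↦ f (E4.ofTimeSpace s y)) (partialDeriv 0 f (E4.ofTimeSpace s y)) s := by
  have h := hf.hasFDerivAt.comp_hasDerivAt s (hasDerivAt_slice_time y s)
  rw [partialDeriv]
  exact h

/-! ### Differentiation of sphere integrals under the integral sign -/

/-- **Differentiating a sphere integral in a parameter.** Let `Ω ⊆ ℝ × E3` be open, `F`, `F'`
continuous on `Ω` with `∂_s F(s, y) = F'(s, y)` on `Ω`, and `{t} × {|y − ξ| = r} ⊆ Ω`. Then
`s ↦ ∮_{|y−ξ|=r} F(s, y) dμHE[2]` has derivative `∮ F'(t, y) dμHE[2]` at `t` (dominated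
differentiation: by the tube lemma `F'` is bounded on `[t − ε, t + ε] × sphere`, a compact subset
of `Ω`, and the sphere has finite measure). [folklore] -/
theorem hasDerivAt_setIntegral_sphere {Ω : Set (ℝ × E3)} (hΩ : IsOpen Ω) {F F' : ℝ → E3 → ℝ}
    (hF : ContinuousOn (uncurry F) Ω) (hF' : ContinuousOn (uncurry F') Ω)
    (hderiv : ∀ p ∈ Ω, HasDerivAt (fun s ↦ F s p.2) (F' p.1 p.2) p.1)
    {t : ℝ} {ξ : E3} {r : ℝ} (hS : ∀ y ∈ Metric.sphere ξ r, (t, y) ∈ Ω) :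
    HasDerivAt (fun s ↦ ∫ y in Metric.sphere ξ r, F s y ∂(μHE[2] : Measure E3))
      (∫ y in Metric.sphere ξ r, F' t y ∂(μHE[2] : Measure E3)) t := by
  -- a product neighbourhood `u × v ⊆ Ω` of `{t} × sphere`
  obtain ⟨u, v, hu, hv, htu, hSv, huv⟩ := generalized_tube_lemma isCompact_singleton
    (isCompact_sphere ξ r) hΩ (by
      rintro ⟨s, y⟩ ⟨hs, hy⟩
      obtain rfl : s = t := Set.mem_singleton_iff.1 hs
      exact hS y hy)
  have htu' : t ∈ u := htu (Set.mem_singleton t)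
  obtain ⟨ε, hε, hεu⟩ := Metric.isOpen_iff.1 hu t htu'
  -- a uniform bound for `F'` on `closedBall t (ε/2) × sphere`
  set K : Set (ℝ × E3) := Metric.closedBall t (ε / 2) ×ˢ Metric.sphere ξ r with hK
  have hKc : IsCompact K := (isCompact_closedBall t (ε / 2)).prod (isCompact_sphere ξ r)
  have hKΩ : K ⊆ Ω := by
    rintro ⟨s, y⟩ ⟨hs, hy⟩
    refine huv ⟨hεu ?_, hSv hy⟩
    exact Metric.closedBall_subset_ball (by linarith) hs
  obtain ⟨C, hC⟩ := hKc.exists_bound_of_continuousOn (hF'.mono hKΩ)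
  have hmeas : MeasurableSet (Metric.sphere ξ r) := Metric.isClosed_sphere.measurableSet
  -- continuity of the slices
  have hcontF : ∀ s ∈ u, ContinuousOn (F s) (Metric.sphere ξ r) := fun s hs ↦
    hF.comp (Continuous.prodMk_right s).continuousOn fun y hy ↦ huv ⟨hs, hSv hy⟩
  have hcontF' : ContinuousOn (F' t) (Metric.sphere ξ r) :=
    hF'.comp (Continuous.prodMk_right t).continuousOn fun y hy ↦ huv ⟨htu', hSv hy⟩
  have hfin : (μHE[2] : Measure E3) (Metric.sphere ξ r) < ⊤ := euclideanHausdorff_sphere_lt_top ξ r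
  have key := hasDerivAt_integral_of_dominated_loc_of_deriv_le
    (μ := (μHE[2] : Measure E3).restrict (Metric.sphere ξ r)) (F := F) (F' := F') (x₀ := t)
    (bound := fun _ ↦ C) (s := Metric.ball t (ε / 2)) (Metric.ball_mem_nhds t (by positivity))
    ?_ ?_ ?_ ?_ ?_ ?_
  · exact key.2
  · filter_upwards [hu.mem_nhds htu'] with s hs
    exact (hcontF s hs).aestronglyMeasurable hmeas
  · exact integrableOn_sphere_of_continuousOn (hcontF t htu')
  · exact hcontF'.aestronglyMeasurable hmeas
  · refine (ae_restrict_iff' hmeas).2 (ae_of_all _ fun y hy s hs ↦ ?_)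
    exact hC (s, y) ⟨Metric.ball_subset_closedBall hs, hy⟩
  · exact integrableOn_const hfin.ne
  · refine (ae_restrict_iff' hmeas).2 (ae_of_all _ fun y hy s hs ↦ ?_)
    exact hderiv (s, y) (huv ⟨hεu (Metric.closedBall_subset_ball (by linarith)
      (Metric.ball_subset_closedBall hs)), hSv hy⟩)


/-! ### The abstract sphere flux law for an antisymmetric superpotential -/

/-- **Sphere flux law for an antisymmetric superpotential** (the mechanism of LL (96.10)–(96.17)
on a coordinate sphere, "no interior needed"). Let `Φ^{λα}` be functions on `E4`, antisymmetric in
`(λ, α)` and `C²` on an open set `U` containing the slice `{t} × {|y − ξ| = R}`, `R > 0`, and let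
`J^λ = Σ_α ∂_α Φ^{λα}` be its (identically conserved) divergence. Then the sphere charge
`Q(s) = ∮_{|y−ξ|=R} Σ_k Φ^{0k}(s, y) n_k dσ` satisfies `dQ/dt = −∮ Σ_k J^k(t, y) n_k dσ`:
indeed `∂_0 Φ^{0k} = −J^k + Σ_b ∂_b Φ^{kb}` by antisymmetry, and the last term is a spatial curl
whose flux through the closed sphere vanishes (`setIntegral_sphere_curl_eq_zero'`).
[cite: LandauLifshitz1975, §96 (96.10)–(96.16)] -/
theorem hasDerivAt_sphereCharge_of_antisymm {U : Set E4} (hU : IsOpen U)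
    {Φ : E4 → Fin 4 → Fin 4 → ℝ} (hanti : ∀ x l n, Φ x n l = -Φ x l n)
    (hΦ : ∀ l n, ContDiffOn ℝ 2 (fun x ↦ Φ x l n) U) {t R : ℝ} {ξ : E3} (hR : 0 < R)
    (hS : ∀ y ∈ Metric.sphere ξ R, E4.ofTimeSpace t y ∈ U) :
    HasDerivAt (fun s ↦ ∫ y in Metric.sphere ξ R,
        ∑ k : Fin 3, Φ (E4.ofTimeSpace s y) 0 k.succ * (y - ξ) k / R ∂(μHE[2] : Measure E3))
      (-∫ y in Metric.sphere ξ R, ∑ k : Fin 3,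
        (∑ n : Fin 4, partialDeriv n (fun z ↦ Φ z k.succ n) (E4.ofTimeSpace t y)) * (y - ξ) k / R
          ∂(μHE[2] : Measure E3)) t := by
  -- the open parameter region and the integrands
  set Ω : Set (ℝ × E3) := {p | E4.ofTimeSpace p.1 p.2 ∈ U} with hΩ
  have hΩo : IsOpen Ω := hU.preimage continuous_slice_uncurry
  have hSΩ : ∀ y ∈ Metric.sphere ξ R, (t, y) ∈ Ω := fun y hy ↦ hS y hy
  set F : ℝ → E3 → ℝ := fun s y ↦
    ∑ k : Fin 3, Φ (E4.ofTimeSpace s y) 0 k.succ * (y - ξ) k / R with hF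
  set F' : ℝ → E3 → ℝ := fun s y ↦
    ∑ k : Fin 3, partialDeriv 0 (fun z ↦ Φ z 0 k.succ) (E4.ofTimeSpace s y) * (y - ξ) k / R
    with hF'
  -- regularity of the components along the slices
  have hΦc : ∀ l n, ContinuousOn (fun x ↦ Φ x l n) U := fun l n ↦ (hΦ l n).continuousOn
  have hdΦc : ∀ l n, ContinuousOn (fun x ↦ fderiv ℝ (fun z ↦ Φ z l n) x) U := fun l n ↦
    ((hΦ l n).fderiv_of_isOpen (m := 1) hU (by norm_num)).continuousOn
  have hΦd : ∀ l n, ∀ x ∈ U, DifferentiableAt ℝ (fun z ↦ Φ z l n) x := fun l n x hx ↦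
    ((hΦ l n).contDiffAt (hU.mem_nhds hx)).differentiableAt (by norm_num)
  have hcoord : ∀ k : Fin 3, Continuous fun p : ℝ × E3 ↦ (p.2 - ξ) k / R := fun k ↦ by
    fun_prop
  have hFc : ContinuousOn (uncurry F) Ω := by
    refine continuousOn_finsetSum _ fun k _ ↦ ?_
    have h1 : ContinuousOn (fun p : ℝ × E3 ↦ Φ (E4.ofTimeSpace p.1 p.2) 0 k.succ) Ω :=
      (hΦc 0 k.succ).comp continuous_slice_uncurry.continuousOn fun p hp ↦ hp
    simpa only [mul_div_assoc, Pi.mul_def] using h1.mul (hcoord k).continuousOn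
  have hF'c : ContinuousOn (uncurry F') Ω := by
    refine continuousOn_finsetSum _ fun k _ ↦ ?_
    have h1 : ContinuousOn
        (fun p : ℝ × E3 ↦ partialDeriv 0 (fun z ↦ Φ z 0 k.succ) (E4.ofTimeSpace p.1 p.2)) Ω := by
      simp only [partialDeriv]
      exact ((hdΦc 0 k.succ).comp continuous_slice_uncurry.continuousOn fun p hp ↦ hp).clm_apply
        continuousOn_const
    simpa only [mul_div_assoc, Pi.mul_def] using h1.mul (hcoord k).continuousOn
  have hFd : ∀ p ∈ Ω, HasDerivAt (fun s ↦ F s p.2) (F' p.1 p.2) p.1 := by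
    rintro ⟨s, y⟩ hp
    simp only [hF, hF']
    refine HasDerivAt.fun_sum fun k _ ↦ ?_
    have h := (hasDerivAt_comp_slice_time (hΦd 0 k.succ _ hp)).mul_const ((y - ξ) k / R)
    simpa only [mul_div_assoc] using h
  -- differentiate under the integral sign
  have hD := hasDerivAt_setIntegral_sphere hΩo hFc hF'c hFd hSΩ
  simp only [hF] at hD
  convert hD using 1
  -- the value of the derivative: `∂_0 Φ^{0k} = −J^k + (curl)`, and the curl has no flux
  have hsplit : ∀ y ∈ Metric.sphere ξ R, F' t y =
      -(∑ k : Fin 3, (∑ n : Fin 4, partialDeriv n (fun z ↦ Φ z k.succ n) (E4.ofTimeSpace t y)) *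
          (y - ξ) k / R) +
        ∑ k : Fin 3, (∑ b : Fin 3, partialDeriv b.succ (fun z ↦ Φ z k.succ b.succ)
          (E4.ofTimeSpace t y)) * (y - ξ) k / R := by
    intro y hy
    simp only [hF']
    rw [← Finset.sum_neg_distrib, ← Finset.sum_add_distrib]
    refine Finset.sum_congr rfl fun k _ ↦ ?_
    have h0 : partialDeriv 0 (fun z ↦ Φ z k.succ 0) (E4.ofTimeSpace t y) =
        -partialDeriv 0 (fun z ↦ Φ z 0 k.succ) (E4.ofTimeSpace t y) := by
      have hf : (fun z ↦ Φ z k.succ 0) = fun z ↦ -Φ z 0 k.succ := funext fun z ↦ hanti z 0 k.succ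
      rw [partialDeriv, partialDeriv, hf, fderiv_fun_neg]
      rfl
    rw [Fin.sum_univ_succ, h0]
    ring
  have hJc : ContinuousOn (fun y ↦ ∑ k : Fin 3,
      (∑ n : Fin 4, partialDeriv n (fun z ↦ Φ z k.succ n) (E4.ofTimeSpace t y)) * (y - ξ) k / R)
      (Metric.sphere ξ R) := by
    refine continuousOn_finsetSum _ fun k _ ↦ ?_
    have h1 : ContinuousOn (fun y ↦ ∑ n : Fin 4,
        partialDeriv n (fun z ↦ Φ z k.succ n) (E4.ofTimeSpace t y)) (Metric.sphere ξ R) := by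
      refine continuousOn_finsetSum _ fun n _ ↦ ?_
      simp only [partialDeriv]
      exact ((hdΦc k.succ n).comp (E4.continuous_ofTimeSpace t).continuousOn hS).clm_apply
        continuousOn_const
    have h2 : ContinuousOn (fun y : E3 ↦ (y - ξ) k / R) (Metric.sphere ξ R) :=
      (Continuous.continuousOn (by fun_prop))
    simpa only [mul_div_assoc, Pi.mul_def] using h1.mul h2
  have hCc : ContinuousOn (fun y ↦ ∑ k : Fin 3, (∑ b : Fin 3,
      partialDeriv b.succ (fun z ↦ Φ z k.succ b.succ) (E4.ofTimeSpace t y)) * (y - ξ) k / R)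
      (Metric.sphere ξ R) := by
    refine continuousOn_finsetSum _ fun k _ ↦ ?_
    have h1 : ContinuousOn (fun y ↦ ∑ b : Fin 3,
        partialDeriv b.succ (fun z ↦ Φ z k.succ b.succ) (E4.ofTimeSpace t y))
        (Metric.sphere ξ R) := by
      refine continuousOn_finsetSum _ fun b _ ↦ ?_
      simp only [partialDeriv]
      exact ((hdΦc k.succ b.succ).comp (E4.continuous_ofTimeSpace t).continuousOn hS).clm_apply
        continuousOn_const
    have h2 : ContinuousOn (fun y : E3 ↦ (y - ξ) k / R) (Metric.sphere ξ R) :=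
      (Continuous.continuousOn (by fun_prop))
    simpa only [mul_div_assoc, Pi.mul_def] using h1.mul h2
  -- the curl term: `W^{ab}(y) = Φ^{(a+1)(b+1)}(t, y)`
  set V : Set E3 := {y | E4.ofTimeSpace t y ∈ U} with hV
  have hVo : IsOpen V := hU.preimage (E4.continuous_ofTimeSpace t)
  have hSV : Metric.sphere ξ R ⊆ V := fun y hy ↦ hS y hy
  set W : E3 → Fin 3 → Fin 3 → ℝ := fun y a b ↦ Φ (E4.ofTimeSpace t y) a.succ b.succ with hW
  have hWanti : ∀ y a b, W y a b = -W y b a := fun y a b ↦ hanti _ _ _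
  have hWs : ∀ a b, ContDiffOn ℝ 2 (fun y ↦ W y a b) V := fun a b ↦
    (hΦ a.succ b.succ).comp (contDiff_slice t).contDiffOn fun y hy ↦ hy
  have hcurl := setIntegral_sphere_curl_eq_zero' hVo hR hSV hWanti hWs
  have hcurl' : ∫ y in Metric.sphere ξ R, ∑ k : Fin 3, (∑ b : Fin 3,
      partialDeriv b.succ (fun z ↦ Φ z k.succ b.succ) (E4.ofTimeSpace t y)) * (y - ξ) k / R
        ∂(μHE[2] : Measure E3) = 0 := by
    rw [← hcurl]
    refine setIntegral_congr_fun Metric.isClosed_sphere.measurableSet fun y hy ↦ ?_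
    refine Finset.sum_congr rfl fun k _ ↦ ?_
    congr 1
    congr 1
    refine Finset.sum_congr rfl fun b _ ↦ ?_
    exact (fderiv_comp_slice (hΦd k.succ b.succ _ (hS y hy)) b).symm
  have hJi : IntegrableOn (fun y ↦ -(∑ k : Fin 3,
      (∑ n : Fin 4, partialDeriv n (fun z ↦ Φ z k.succ n) (E4.ofTimeSpace t y)) * (y - ξ) k / R))
      (Metric.sphere ξ R) (μHE[2] : Measure E3) := (integrableOn_sphere_of_continuousOn hJc).neg
  rw [setIntegral_congr_fun Metric.isClosed_sphere.measurableSet hsplit,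
    integral_add hJi (integrableOn_sphere_of_continuousOn hCc), integral_neg, hcurl', add_zero]


/-! ### Smoothness of the Landau–Lifshitz objects on `U` -/

section Smooth

variable {g : E4 → E4 →L[ℝ] E4 →L[ℝ] ℝ} {U : Set E4} {n m : WithTop ℕ∞}

/-- The metric components `y ↦ g_{μν}(y)` are as smooth as `g`. [folklore] -/
theorem gram_contDiffOn (hg : ContDiffOn ℝ n g U) (μ ν : Fin 4) :
    ContDiffOn ℝ n (fun y ↦ gram g y μ ν) U := by
  simp only [gram_apply]
  exact (hg.clm_apply contDiffOn_const).clm_apply contDiffOn_const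

/-- The determinant `y ↦ det (g_{μν}(y))` is as smooth as `g` (Leibniz formula). [folklore] -/
theorem metricDet_contDiffOn (hg : ContDiffOn ℝ n g U) :
    ContDiffOn ℝ n (fun y ↦ metricDet g y) U := by
  unfold metricDet
  simp_rw [Matrix.det_apply']
  exact ContDiffOn.sum fun σ _ ↦ contDiffOn_const.mul
    (contDiffOn_prod fun i _ ↦ gram_contDiffOn hg _ _)

/-- The adjugate entries `y ↦ adj (g_{μν}(y))_{ij}` are as smooth as `g`. [folklore] -/
theorem adjugate_gram_contDiffOn (hg : ContDiffOn ℝ n g U) (i j : Fin 4) :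
    ContDiffOn ℝ n (fun y ↦ (gram g y).adjugate i j) U := by
  simp_rw [Matrix.adjugate_apply, Matrix.det_apply']
  refine ContDiffOn.sum fun σ _ ↦ contDiffOn_const.mul (contDiffOn_prod fun k _ ↦ ?_)
  by_cases h : (σ k : Fin 4) = j
  · simp_rw [Matrix.updateRow_apply, if_pos h]
    exact contDiffOn_const
  · simp_rw [Matrix.updateRow_apply, if_neg h]
    exact gram_contDiffOn hg _ _

/-- **The inverse components `y ↦ g^{μν}(y)` are as smooth as `g` where `det (g_{μν}) ≠ 0`**
(Cramer's rule `A⁻¹ = (det A)⁻¹ adj A`). [folklore] -/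
theorem upper_contDiffOn (hg : ContDiffOn ℝ n g U) (hdet : ∀ x ∈ U, metricDet g x ≠ 0)
    (μ ν : Fin 4) : ContDiffOn ℝ n (fun y ↦ upper g y μ ν) U := by
  have h : ∀ y, upper g y μ ν = (metricDet g y)⁻¹ * (gram g y).adjugate μ ν := by
    intro y
    rw [upper, Matrix.inv_def, Matrix.smul_apply, smul_eq_mul, Ring.inverse_eq_inv]
    rfl
  simp_rw [h]
  exact ((metricDet_contDiffOn hg).inv hdet).mul (adjugate_gram_contDiffOn hg μ ν)

/-- The superpotential `y ↦ H^{μανβ}(y)` is as smooth as `g` where `det (g_{μν}) ≠ 0`.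
[cite: LandauLifshitz1975, §96 (96.3)] -/
theorem superpotential_contDiffOn (hg : ContDiffOn ℝ n g U) (hdet : ∀ x ∈ U, metricDet g x ≠ 0)
    (μ α ν β : Fin 4) : ContDiffOn ℝ n (fun y ↦ superpotential g y μ α ν β) U := by
  unfold superpotential
  exact (metricDet_contDiffOn hg).neg.mul
    (((upper_contDiffOn hg hdet μ ν).mul (upper_contDiffOn hg hdet α β)).sub
      ((upper_contDiffOn hg hdet α ν).mul (upper_contDiffOn hg hdet μ β)))

/-- `y ↦ λ^{iklm}(y)` is as smooth as `g` where `det (g_{μν}) ≠ 0`.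
[cite: LandauLifshitz1975, §96 (96.3)] -/
theorem lambdaLL_contDiffOn (hg : ContDiffOn ℝ n g U) (hdet : ∀ x ∈ U, metricDet g x ≠ 0)
    (i k l m : Fin 4) : ContDiffOn ℝ n (fun y ↦ lambdaLL g y i k l m) U := by
  unfold lambdaLL
  exact contDiffOn_const.mul ((metricDet_contDiffOn hg).neg.mul
    (((upper_contDiffOn hg hdet i k).mul (upper_contDiffOn hg hdet l m)).sub
      ((upper_contDiffOn hg hdet i l).mul (upper_contDiffOn hg hdet k m))))

/-- A coordinate partial derivative of a `C^n` function on the open set `U` is `C^m` on `U` for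
`m + 1 ≤ n`. [folklore] -/
theorem partialDeriv_contDiffOn (hU : IsOpen U) {f : E4 → ℝ} (hf : ContDiffOn ℝ n f U)
    (hmn : m + 1 ≤ n) (β : Fin 4) : ContDiffOn ℝ m (fun y ↦ partialDeriv β f y) U := by
  simp only [partialDeriv]
  exact (hf.fderiv_of_isOpen hU hmn).clm_apply contDiffOn_const

/-- **LL's `h^{μνα}` is `C^m` where `g` is `C^n`, `m + 1 ≤ n`, and `det (g_{μν}) ≠ 0`.**
[cite: LandauLifshitz1975, §96 (96.2)] -/
theorem hField_contDiffOn (hU : IsOpen U) (hg : ContDiffOn ℝ n g U)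
    (hdet : ∀ x ∈ U, metricDet g x ≠ 0) (hmn : m + 1 ≤ n) (μ ν α : Fin 4) :
    ContDiffOn ℝ m (fun y ↦ hField g y μ ν α) U := by
  unfold hField
  exact contDiffOn_const.mul (ContDiffOn.sum fun β _ ↦
    partialDeriv_contDiffOn hU (superpotential_contDiffOn hg hdet μ β ν α) hmn β)

/-- The energy–momentum complex `y ↦ Σ_α ∂_α h^{μνα}` is `C^m` where `g` is `C^n`, `m + 2 ≤ n`, and
`det (g_{μν}) ≠ 0`. [cite: LandauLifshitz1975, §96 (96.5)] -/
theorem emComplex_contDiffOn (hU : IsOpen U) (hg : ContDiffOn ℝ n g U)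
    (hdet : ∀ x ∈ U, metricDet g x ≠ 0) (hmn : m + 2 ≤ n) (μ ν : Fin 4) :
    ContDiffOn ℝ m (fun y ↦ emComplex g y μ ν) U := by
  have hmn' : m + 1 + 1 ≤ n := by rwa [add_assoc, one_add_one_eq_two]
  unfold emComplex
  exact ContDiffOn.sum fun α _ ↦
    partialDeriv_contDiffOn hU (hField_contDiffOn hU hg hdet hmn' μ ν α) le_rfl α

/-- The coordinate functions `y ↦ (y − a)^i` have derivative `v ↦ v^i`. [folklore] -/
theorem hasFDerivAt_coord_sub (a x : E4) (i : Fin 4) :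
    HasFDerivAt (fun y : E4 ↦ (y - a) i) (EuclideanSpace.proj i : E4 →L[ℝ] ℝ) x := by
  have h : (fun y : E4 ↦ (y - a) i) = fun y ↦ (EuclideanSpace.proj i : E4 →L[ℝ] ℝ) y - a i := by
    funext y
    simp [PiLp.sub_apply]
  rw [h]
  exact (EuclideanSpace.proj i : E4 →L[ℝ] ℝ).hasFDerivAt.sub_const _

/-- The coordinate functions `y ↦ (y − a)^i` are smooth. [folklore] -/
theorem coord_sub_contDiff (a : E4) (i : Fin 4) : ContDiff ℝ n (fun y : E4 ↦ (y - a) i) := by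
  have h : (fun y : E4 ↦ (y - a) i) = fun y ↦ (EuclideanSpace.proj i : E4 →L[ℝ] ℝ) y - a i := by
    funext y
    simp [PiLp.sub_apply]
  rw [h]
  exact (EuclideanSpace.proj i : E4 →L[ℝ] ℝ).contDiff.sub contDiff_const

/-- The angular-momentum superpotential `y ↦ Ψ_a^{μν|λα}(y)` is `C^m` where `g` is `C^n`,
`m + 1 ≤ n`, and `det (g_{μν}) ≠ 0`. [cite: LandauLifshitz1975, §96 (96.17)] -/
theorem amSuperpotential_contDiffOn (hU : IsOpen U) (hg : ContDiffOn ℝ n g U)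
    (hdet : ∀ x ∈ U, metricDet g x ≠ 0) (hmn : m + 1 ≤ n) (a : E4) (μ ν l k : Fin 4) :
    ContDiffOn ℝ m (fun y ↦ amSuperpotential g a y μ ν l k) U := by
  have hmn' : m ≤ n := le_trans le_self_add hmn
  unfold amSuperpotential
  exact (((coord_sub_contDiff a μ).contDiffOn.mul (hField_contDiffOn hU hg hdet hmn ν l k)).sub
    ((coord_sub_contDiff a ν).contDiffOn.mul (hField_contDiffOn hU hg hdet hmn μ l k))).add
    ((lambdaLL_contDiffOn hg hdet μ l k ν).of_le hmn')

end Smooth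

/-! ### The flux law for the four-momentum: `dP^μ/dt = −∮ (−g)(T^{μk} + t^{μk}) n_k` -/

section Momentum

variable {g : E4 → E4 →L[ℝ] E4 →L[ℝ] ℝ} {U : Set E4}

/-- **LL's balance law for the quasi-local four-momentum of a coordinate sphere, for every smooth
nondegenerate field of components** (LL (96.10) with (96.16); no field equations, no symmetry and
no interior needed): if `g` is `C^∞` with `det (g_{μν}) ≠ 0` on an open `U ⊆ E4` containing the
slice `{t} × {|y − ξ| = R}`, `R > 0`, then
`d/dt P^μ(t; ξ, R) = −∮_{|y−ξ|=R} Σ_k (Σ_α ∂_α h^{μkα})(t, y) (y − ξ)_k / R dσ`, the flux of the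
energy–momentum complex `emComplex = (−g)(T^{μk} + t^{μk})` (96.5). Instance of
`hasDerivAt_sphereCharge_of_antisymm` with `Φ^{λα} = h^{μλα}` (antisymmetric by (96.4)).
[cite: LandauLifshitz1975, §96 (96.10)–(96.16)] -/
theorem hasDerivAt_quasiLocalMomentum (hU : IsOpen U) (hg : ContDiffOn ℝ ∞ g U)
    (hdet : ∀ x ∈ U, metricDet g x ≠ 0) {t R : ℝ} {ξ : E3} (hR : 0 < R)
    (hS : ∀ y ∈ Metric.sphere ξ R, E4.ofTimeSpace t y ∈ U) (μ : Fin 4) :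
    HasDerivAt (fun s ↦ quasiLocalMomentum g s ξ R μ)
      (-∫ y in Metric.sphere ξ R, ∑ k : Fin 3,
        emComplex g (E4.ofTimeSpace t y) μ k.succ * (y - ξ) k / R ∂(μHE[2] : Measure E3)) t := by
  have h := hasDerivAt_sphereCharge_of_antisymm hU (Φ := fun x l n ↦ hField g x μ l n)
    (fun x l n ↦ hField_swap g x μ l n)
    (fun l n ↦ hField_contDiffOn hU hg hdet (by norm_cast) μ l n) hR hS
  exact h

/-- **LL's balance law in vacuum**: if moreover `Ric(g) = 0` on `U`, then `G^{μν} = 0` there, the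
complex is `(−g) t^{μν}_LL` on `U`, and `d/dt P^μ(t; ξ, R) = −Φ^μ(t; ξ, R)` with `Φ^μ = momentumFlux`
the flux of the pseudotensor density (LL (96.10)–(96.12), (96.16); the shape of clause (iv) of the
route item `LLBalanceLaw`). [cite: LandauLifshitz1975, §96 (96.11)–(96.16)] -/
theorem hasDerivAt_quasiLocalMomentum_of_ricciFlat (hU : IsOpen U) (hg : ContDiffOn ℝ ∞ g U)
    (hdet : ∀ x ∈ U, metricDet g x ≠ 0) (hric : ∀ x ∈ U, MetricCoord.ricAt g x = 0)
    {t R : ℝ} {ξ : E3} (hR : 0 < R) (hS : ∀ y ∈ Metric.sphere ξ R, E4.ofTimeSpace t y ∈ U)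
    (μ : Fin 4) :
    HasDerivAt (fun s ↦ quasiLocalMomentum g s ξ R μ) (-momentumFlux g t ξ R μ) t := by
  have h := hasDerivAt_quasiLocalMomentum hU hg hdet hR hS μ
  have hG : ∀ x ∈ U, ∀ ν, einsteinUpper g x μ ν = 0 := fun x hx ν ↦ by
    have hr : ∀ α β : Fin 4, ricci g x α β = 0 := fun α β ↦ by simp [ricci, hric x hx]
    simp [einsteinUpper, scalar, hr]
  have hem : ∀ x ∈ U, ∀ ν, emComplex g x μ ν = -metricDet g x * pseudotensor g x μ ν := by
    intro x hx ν
    rw [pseudotensor, hG x hx ν, mul_zero, sub_zero, ← mul_assoc,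
      mul_inv_cancel₀ (neg_ne_zero.mpr (hdet x hx)), one_mul]
  have hflux : momentumFlux g t ξ R μ = ∫ y in Metric.sphere ξ R, ∑ k : Fin 3,
      emComplex g (E4.ofTimeSpace t y) μ k.succ * (y - ξ) k / R ∂(μHE[2] : Measure E3) := by
    rw [momentumFlux]
    refine setIntegral_congr_fun Metric.isClosed_sphere.measurableSet fun y hy ↦ ?_
    exact Finset.sum_congr rfl fun k _ ↦ by rw [hem _ (hS y hy)]
  rw [hflux]
  exact h

end Momentum


/-! ### The flux law for the angular four-momentum: `dM_a^{μν}/dt = −∮ amComplex^{μνk} n_k` -/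

section AngularMomentum

variable {g : E4 → E4 →L[ℝ] E4 →L[ℝ] ℝ} {U : Set E4}

/-- **Cyclic identity of the superpotential** (first-Bianchi type, in the slots `1, 3, 4` with the
second slot fixed): `H^{iβlk} + H^{kβil} + H^{lβki} = 0` for symmetric components — the algebraic
fact behind LL's `λ^{ilkn} − λ^{klin} = λ^{ilnk}`. [cite: LandauLifshitz1975, §96 (96.17)] -/
theorem superpotential_cyclic {x : E4} (hs : ∀ v w : E4, g x v w = g x w v) (i β l k : Fin 4) :
    superpotential g x i β l k + superpotential g x k β i l + superpotential g x l β k i = 0 := by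
  simp only [superpotential, upper_comm hs i k, upper_comm hs k l, upper_comm hs i l]
  ring

/-- **Cyclic identity of `h`**: `h^{ilk} + h^{kil} + h^{lki} = 0` at points of an open set on which
the components are symmetric, `C^∞` and nondegenerate (differentiate `superpotential_cyclic`).
[cite: LandauLifshitz1975, §96 (96.17)] -/
theorem hField_cyclic (hU : IsOpen U) (hg : ContDiffOn ℝ ∞ g U)
    (hdet : ∀ x ∈ U, metricDet g x ≠ 0) (hs : ∀ x ∈ U, ∀ v w : E4, g x v w = g x w v)
    {x : E4} (hx : x ∈ U) (i l k : Fin 4) :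
    hField g x i l k + hField g x k i l + hField g x l k i = 0 := by
  have hdiff : ∀ μ α ν β : Fin 4, DifferentiableAt ℝ (fun y ↦ superpotential g y μ α ν β) x :=
    fun μ α ν β ↦ ((superpotential_contDiffOn hg hdet μ α ν β).contDiffAt
      (hU.mem_nhds hx)).differentiableAt (by simp)
  simp only [hField, ← mul_add, ← Finset.sum_add_distrib]
  refine mul_eq_zero_of_right _ (Finset.sum_eq_zero fun β _ ↦ ?_)
  have hev : (fun y ↦ superpotential g y i β l k + superpotential g y k β i l +
      superpotential g y l β k i) =ᶠ[𝓝 x] fun _ ↦ (0 : ℝ) := by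
    filter_upwards [hU.mem_nhds hx] with y hy
    exact superpotential_cyclic (hs y hy) i β l k
  rw [partialDeriv, partialDeriv, partialDeriv, ← _root_.add_apply,
    ← _root_.add_apply, ← fderiv_fun_add (hdiff _ _ _ _) (hdiff _ _ _ _),
    ← fderiv_fun_add ((hdiff _ _ _ _).fun_add (hdiff _ _ _ _)) (hdiff _ _ _ _), hev.fderiv_eq]
  simp

/-- **The divergence of the `λ`-term**: `Σ_n ∂_n λ^{ilnk} = h^{lik}` on `U` (for symmetric
components `λ^{ilnk} = (16π)⁻¹ H^{lnik}`, and `h^{lik} = (16π)⁻¹ Σ_n ∂_n H^{lnik}` by definition).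
[cite: LandauLifshitz1975, §96 (96.2)–(96.3)] -/
theorem sum_partialDeriv_lambdaLL (hU : IsOpen U) (hg : ContDiffOn ℝ ∞ g U)
    (hdet : ∀ x ∈ U, metricDet g x ≠ 0) (hs : ∀ x ∈ U, ∀ v w : E4, g x v w = g x w v)
    {x : E4} (hx : x ∈ U) (i l k : Fin 4) :
    ∑ n : Fin 4, partialDeriv n (fun y ↦ lambdaLL g y i l n k) x = hField g x l i k := by
  have hdiff : ∀ μ α ν β : Fin 4, DifferentiableAt ℝ (fun y ↦ superpotential g y μ α ν β) x :=
    fun μ α ν β ↦ ((superpotential_contDiffOn hg hdet μ α ν β).contDiffAt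
      (hU.mem_nhds hx)).differentiableAt (by simp)
  have hev : ∀ n : Fin 4, (fun y ↦ lambdaLL g y i l n k) =ᶠ[𝓝 x]
      fun y ↦ (16 * Real.pi)⁻¹ * superpotential g y l n i k := by
    intro n
    filter_upwards [hU.mem_nhds hx] with y hy
    rw [lambdaLL_eq (hs y hy) i l n k, superpotential_pair_comm (hs y hy) l n i k]
  have hd : ∀ n : Fin 4, partialDeriv n (fun y ↦ lambdaLL g y i l n k) x =
      (16 * Real.pi)⁻¹ * partialDeriv n (fun y ↦ superpotential g y l n i k) x := by
    intro n
    rw [partialDeriv, partialDeriv, (hev n).fderiv_eq, fderiv_const_mul (hdiff l n i k)]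
    rfl
  simp only [hd, ← Finset.mul_sum, hField]

/-- **Leibniz rule for the lever arms**: `Σ_n ∂_n [(y − a)^i f_n] = f_i + (x − a)^i Σ_n ∂_n f_n`.
[folklore] -/
theorem sum_partialDeriv_coord_mul (a x : E4) (i : Fin 4) {f : Fin 4 → E4 → ℝ}
    (hf : ∀ n, DifferentiableAt ℝ (f n) x) :
    ∑ n : Fin 4, partialDeriv n (fun y ↦ (y - a) i * f n y) x =
      f i x + (x - a) i * ∑ n : Fin 4, partialDeriv n (f n) x := by
  have h : ∀ n : Fin 4, partialDeriv n (fun y ↦ (y - a) i * f n y) x =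
      (x - a) i * partialDeriv n (f n) x + f n x * (if i = n then 1 else 0) := by
    intro n
    rw [partialDeriv, partialDeriv,
      fderiv_fun_mul (hasFDerivAt_coord_sub a x i).differentiableAt (hf n),
      (hasFDerivAt_coord_sub a x i).fderiv]
    simp [PiLp.single_apply, E4.basisVector]
  simp only [h, Finset.sum_add_distrib, ← Finset.mul_sum, mul_ite, mul_one, mul_zero,
    Finset.sum_ite_eq, Finset.mem_univ, if_true]
  ring

/-- **The divergence of the angular-momentum superpotential is the angular-momentum complex**:
`Σ_n ∂_n Ψ_a^{ik|λn} = (x − a)^i τ^{kλ} − (x − a)^k τ^{iλ}` on `U` (symmetric, smooth, nondegenerate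
components) — LL's integration by parts behind (96.17): the `h`-terms produced by the lever arms,
`h^{kλi} − h^{iλk}`, cancel against `Σ_n ∂_n λ^{iλnk} = h^{λik}` by the cyclic identity and (96.4).
[cite: LandauLifshitz1975, §96 (96.17)] -/
theorem sum_partialDeriv_amSuperpotential (hU : IsOpen U) (hg : ContDiffOn ℝ ∞ g U)
    (hdet : ∀ x ∈ U, metricDet g x ≠ 0) (hs : ∀ x ∈ U, ∀ v w : E4, g x v w = g x w v)
    (a : E4) {x : E4} (hx : x ∈ U) (i k l : Fin 4) :
    ∑ n : Fin 4, partialDeriv n (fun y ↦ amSuperpotential g a y i k l n) x = amComplex g a x i k l := by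
  have hhd : ∀ μ ν α : Fin 4, DifferentiableAt ℝ (fun y ↦ hField g y μ ν α) x := fun μ ν α ↦
    ((hField_contDiffOn (m := 1) hU hg hdet (by norm_cast) μ ν α).contDiffAt
      (hU.mem_nhds hx)).differentiableAt one_ne_zero
  have hld : ∀ μ ν α β : Fin 4, DifferentiableAt ℝ (fun y ↦ lambdaLL g y μ ν α β) x :=
    fun μ ν α β ↦ ((lambdaLL_contDiffOn hg hdet μ ν α β).contDiffAt
      (hU.mem_nhds hx)).differentiableAt (by simp)
  have hcd : ∀ (μ : Fin 4) (f : E4 → ℝ), DifferentiableAt ℝ f x →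
      DifferentiableAt ℝ (fun y ↦ (y - a) μ * f y) x := fun μ f hf ↦
    (hasFDerivAt_coord_sub a x μ).differentiableAt.fun_mul hf
  -- split the divergence into its three parts
  have hsplit : ∀ n : Fin 4, partialDeriv n (fun y ↦ amSuperpotential g a y i k l n) x =
      partialDeriv n (fun y ↦ (y - a) i * hField g y k l n) x -
        partialDeriv n (fun y ↦ (y - a) k * hField g y i l n) x +
        partialDeriv n (fun y ↦ lambdaLL g y i l n k) x := by
    intro n
    simp only [partialDeriv, amSuperpotential]
    rw [fderiv_fun_add ((hcd i _ (hhd k l n)).fun_sub (hcd k _ (hhd i l n))) (hld i l n k),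
      fderiv_fun_sub (hcd i _ (hhd k l n)) (hcd k _ (hhd i l n))]
    rfl
  simp only [hsplit, Finset.sum_add_distrib, Finset.sum_sub_distrib]
  rw [sum_partialDeriv_coord_mul a x i (fun n ↦ hhd k l n),
    sum_partialDeriv_coord_mul a x k (fun n ↦ hhd i l n),
    sum_partialDeriv_lambdaLL hU hg hdet hs hx i l k]
  -- the `h`-terms cancel: `h^{kli} − h^{ilk} + h^{lik} = 0`
  have hcyc := hField_cyclic hU hg hdet hs hx i l k
  have h1 := hField_swap g x k i l
  have h2 := hField_swap g x l k i
  simp only [amComplex, emComplex]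
  linarith [hcyc, h1, h2]

/-- **LL's balance law for the quasi-local angular four-momentum of a coordinate sphere about a
fixed event** (LL (96.10) with (96.13) and (96.17); no field equations and no interior needed): if
`g` is `C^∞`, symmetric and nondegenerate on an open `U ⊆ E4` containing the slice
`{t} × {|y − ξ| = R}`, `R > 0`, then for every reference event `a` and indices `μ ν`,
`d/dt M_a^{μν}(t; ξ, R) = −Φ_a^{μν}(t; ξ, R) = −∮ Σ_k [(x − a)^μ τ^{νk} − (x − a)^ν τ^{μk}] n_k dσ`
with `τ = (−g)(T + t)` the energy–momentum complex. Instance of `hasDerivAt_sphereCharge_of_antisymm`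
with `Φ^{λα} = Ψ_a^{μν|λα}`, whose divergence is the angular-momentum complex
(`sum_partialDeriv_amSuperpotential`). In vacuum near the sphere `τ^{μk} = (−g) t^{μk}_LL`.
[cite: LandauLifshitz1975, §96 (96.13)–(96.17)] -/
theorem hasDerivAt_angularMomentumChargeAbout (hU : IsOpen U) (hg : ContDiffOn ℝ ∞ g U)
    (hdet : ∀ x ∈ U, metricDet g x ≠ 0) (hs : ∀ x ∈ U, ∀ v w : E4, g x v w = g x w v)
    (a : E4) {t R : ℝ} {ξ : E3} (hR : 0 < R)
    (hS : ∀ y ∈ Metric.sphere ξ R, E4.ofTimeSpace t y ∈ U) (μ ν : Fin 4) :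
    HasDerivAt (fun s ↦ angularMomentumChargeAbout g a s ξ R μ ν)
      (-angularMomentumFluxAbout g a t ξ R μ ν) t := by
  have h := hasDerivAt_sphereCharge_of_antisymm hU (Φ := fun x l n ↦ amSuperpotential g a x μ ν l n)
    (fun x l n ↦ amSuperpotential_swap_right g a x μ ν l n)
    (fun l n ↦ amSuperpotential_contDiffOn hU hg hdet (by norm_cast) a μ ν l n) hR hS
  have hflux : angularMomentumFluxAbout g a t ξ R μ ν = ∫ y in Metric.sphere ξ R, ∑ k : Fin 3,
      (∑ n : Fin 4, partialDeriv n (fun z ↦ amSuperpotential g a z μ ν k.succ n)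
        (E4.ofTimeSpace t y)) * (y - ξ) k / R ∂(μHE[2] : Measure E3) := by
    rw [angularMomentumFluxAbout]
    refine setIntegral_congr_fun Metric.isClosed_sphere.measurableSet fun y hy ↦ ?_
    exact Finset.sum_congr rfl fun k _ ↦ by
      rw [sum_partialDeriv_amSuperpotential hU hg hdet hs a (hS y hy)]
  rw [hflux]
  exact h

/-- The same for a Lorentzian sign condition `det (g_{μν}) < 0` (the hypothesis of the route item
`LLBalanceLaw`). [cite: LandauLifshitz1975, §96 (96.13)–(96.17)] -/
theorem hasDerivAt_angularMomentumChargeAbout_of_metricDet_neg (hU : IsOpen U)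
    (hg : ContDiffOn ℝ ∞ g U) (hdet : ∀ x ∈ U, metricDet g x < 0)
    (hs : ∀ x ∈ U, ∀ v w : E4, g x v w = g x w v) (a : E4) {t R : ℝ} {ξ : E3} (hR : 0 < R)
    (hS : ∀ y ∈ Metric.sphere ξ R, E4.ofTimeSpace t y ∈ U) (μ ν : Fin 4) :
    HasDerivAt (fun s ↦ angularMomentumChargeAbout g a s ξ R μ ν)
      (-angularMomentumFluxAbout g a t ξ R μ ν) t :=
  hasDerivAt_angularMomentumChargeAbout hU hg (fun x hx ↦ (hdet x hx).ne) hs a hR hS μ ν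

end AngularMomentum


end LandauLifshitz

end Literature.Geometry.Lorentzian

end
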